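import Literature.MathematicalPhysics.QuantumFieldTheory.Balaban1983to89.B15Prop1WindowDirectPackageFromLetters
import Literature.MathematicalPhysics.QuantumFieldTheory.Balaban1983to89.B15Prop1NumericsThresholds
import Summits.QuantumFields.YangMills.Theorems.BalabanUVNodesN12NearFlatChartLetterBookkeeping

/-!
# BalabanUVNodes ∕ N12 — (P2c)‴ `(iii)_direct` IN THE EXPLICIT-THRESHOLD FRAME WITH THE CHART HALF IN PER-ROW ℓ¹ CURRENCY: (P2c)″ with its chart-half letter re-keyed on dag-n12-c g22's ρ6b
# `N12DirectChartPackageOfClassRowL1Family.exists_hWD_chartHalf_of_class_uniform_rowl1_family` (census U2b at the consumer) — the torus bond count `√#PBond` leaves N12's threshold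

Cell `pub-ymgap` (HUMAN RULINGS D-0062 ∕ D-0149), seat `pub-ymgap-dag-n12-d` g21 (R134 N12 [B15] s2; the v10 re-key recipe of the lane, INBOX l.44281: «in the (P4)′ binders `(B, hB0, hHB)`
↦ `(B₁, hB1, hHB1)` with `hHB1 : ∀ v, (∀ b, b.src ∉ maxDomT ν.M₁ (Z i) 1 → H v b = 0) → Σ_b ‖(H v b : Matrix (Fin 2) (Fin 2) ℂ)‖ ≤ B₁ i · Σ_c ‖v c‖`; in Θ: `√#PBond·B i·M₂ i` ↦ `B₁ i·M₂ i`;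
`hhalf` ↦ the ∀-body of `exists_hWD_chartHalf_of_class_uniform_l1(_family)`»; AMENDED by its INTENT-3, INBOX l.44505: «ρ6b — THE v10 SOCKET I RECOMMEND INSTEAD OF ρ6's `hHB1`:
`(H, hHinv)` stays as a WITNESS OF SURJECTIVITY ONLY and the per-row ℓ¹ preimage letter `hrow : ∀ i, 1 ≤ level i → ∀ ξ, ∃ x, DΨ(0) x = Pi.single i ξ ∧ Σ_b ‖(x b : Matrix)‖ ≤ B₁·‖ξ‖`
replaces `hHB1`; v10 Θ-display unchanged»).  Count-neutral helper of K1⁹ `stmt-QuantumFields-27364` (`--kind proof --supports … --as helper`).  THEOREMS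
ONLY (0 `def`, 0 `instance`, 0 `sorry`); composition BY NAME of dag-n12-c's (ii)_direct §2 `B15Prop1WindowDirectPackageFromLetters.…_ofMinimiserFamily_ofWindowLetters_ofCoercive` (p658881)
and `B15Prop1NumericsThresholds.hsm_direct_of_le_explicitThreshold` (§7) — the same two names (P2c)″ (p680717) composes — plus `N12NearFlatChartLetter.l2Seminorm_le_of_bound_of_support`
∕ `l2Seminorm_apply` (dag-n12-c, `…N12NearFlatChartLetterBookkeeping`) for the ℓ² velocity letter; (P2c)″ itself is not imported (statement surgery, proof re-run).

WHY (census `N12-DIRECT-ROW-CENSUS-2026-08-28.md` §7 U2b; lane ρ6 p683432 ∕ ρ6b).  In (P2c)″ the (μ) row's multiplier bound used the ℓ¹ size of `H v` over the WHOLE torus against the displayed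
ℓ² letter `√(Σ_b ‖(H v)_b‖²) ≤ B‖v‖`, so the explicit torus-volume factor `√#PBond` sat in N12's displayed threshold `Θ`.  ρ6b reads the (μ) row through the LINEARITY
of the multiplier `λ` (one-row data suffice): the right inverse `H` only witnesses surjectivity, its size enters through the PER-ROW ℓ¹ PREIMAGE LETTER `hrow` (every positive-level
`e_i ξ` has a `DΨ(0)`-preimage of ℓ¹ size `≤ B₁‖ξ‖` — the currency in which dag-n12-w6's graded support hull is per height for one-row data), the curvature through the ℓ¹-CURVATURE
LETTER `Σ_c ‖D²Ψ(0)(w,w)_c‖ ≤ M₂·Σ_b ‖w_b‖²`; the (μ) constant becomes `2(d−1)·ε_P·B₁·M₂` with NO cardinality.  This file carries that change to the (iii)_direct endpoint: the threshold's (μ)-term reads `2(d−1)·B₁ i·M₂ i`, every explicit count left in `Θ` is a LARGE-FIELD-REGION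
count (`#bonds(Ω₁(Z_i))` in the (K) row, the window's site count) — the torus volume is gone from the (μ) row.  Today's inhabitants of `B₁`∕`M₂` (ρ6b-Family `hrow_of_hHB1 ∘` ρ6-Family
`hHB1_of_hHB ∘` dag-n12-w6's p678596; ρ7 `sum_norm_fderiv_fderiv_msChart_apply_le_of_class` with the local count `Σ_{j≤k}(2d)^j`) carry a region count ∕ a per-height count INSIDE;
volume-free `B₁` (print's (46) ∕ U2a decay; dag-n12-w6's LOCATED-B) is NOT claimed.

WHAT.  (P2c)″'s statement VERBATIM except: (a) `hhalf i` is the ∀-body of `exists_hWD_chartHalf_of_class_uniform_rowl1_family` at `k i` (after the plaquette premise it asks `∀ H, hHinv →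
∀ ⦃B₁⦄, 0 ≤ B₁ → (∀ i', 1 ≤ level i' → ∀ ξ, ∃ x, DΨ(0) x = Pi.single i' ξ ∧ Σ_b ‖↑x_b‖ ≤ B₁‖ξ‖) → ∀ ⦃M₂⦄, (∀ w, Σ_c ‖D²Ψ(0)(w,w)_c‖ ≤ M₂·Σ_b ‖w_b‖²) → …` and concludes the (μ)
row at `2(d−1)·εP·B₁·M₂`); (b) binders `(B₁ M₂ : ι → ℝ) (hB1 : ∀ i, 0 ≤ B₁ i) (hM₂0 : ∀ i, 0 ≤ M₂ i)`; (c) the (P4)′ socket `hH i … : ∃ H, hHinv ∧ (the per-row ℓ¹ preimage letter at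
B₁ i)`; (d) the (P5)
letter `hM₂ i … : ∀ w, Σ_c ‖D²Ψ(0)(w,w)_c‖ ≤ M₂ i·Σ_b ‖w_b‖²`; (e) in `Θ i` the (μ)-term `2(d−1)·√#PBond·B i·M₂ i` ↦ `2(d−1)·B₁ i·M₂ i`; (f) ρ6b's ℓ² VELOCITY LETTER `hK2 : ∀ X, √(Σ_b ‖(X_f′X)_b‖²) ≤ K₂‖X‖`
(replacing the chart half's `R 𝓐₀ hKb hsupp`) is INHABITED IN-PROOF at today's `K₂ := 12·𝓐₀ i∕R i·√#{b ∕∕ b.src ∈ Ω₁(Z_i)}` from (J0′)'s per-bond Cauchy bound and the velocity's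
support (`N12NearFlatChartLetter.l2Seminorm_le_of_bound_of_support`), so `Θ`'s `Kc_i` text is UNCHANGED and no new letter is displayed (a print-grade `K₂` = the decay of the chart
velocity, census U2a, is NOT claimed).  The window gauge letter `hσW`, the plaquette letter `hPχ`, (J0′) `hMin`, [15] Thm 1 `h15T`, geometry and numerics rows stay as in (P2c)″.  Downstream (this seat, v10): (D1)⁵ `…DirectOfClassOnlyL1` (both sockets fed from the class:
(P4)′ by dag-n12-w6's proxies edition re-keyed through `hHB1_of_hHB` + `hrow_of_hHB1`, (P5) by ρ7 with the local count in closed form `Σ_{j≤k}(2d)^j`), (E1)⁶, knit «v10».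

HONEST FRAMING ∕ LOCATED.  ∃∕∀ bookkeeping by name; display-level change only (which counts sit in the threshold vs inside inhabitants); nothing of Bałaban's asserted; count-neutral;
N12 NOT discharged; K1⁹ NOT closed; counts unmoved; one finite 𝕋⁴ programme at fixed `ε = L^{-K}` — R4 closes only the conditional rung `BalabanLadder.UV`; no summit statement is
proved here and NOT the Yang–Mills mass gap (Clay); nothing continuum ∕ ℝ⁴ ∕ OS.

References: [Balaban1989LargeFieldI] CMP 122 (1989) 175–202, (1.74) p.192, Prop. 1 (1.77)–(1.78) p.194, (1.79) p.195; [Balaban1989LargeFieldII] CMP 122 (1989) 355–392, p.357,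
(1.7)–(1.9) p.358, (1.12)–(1.13) p.359; [Balaban1985Variational] CMP 102 (1985) 277–309, (2)–(4) p.278, Thm 1 (8) p.279, (44)–(48) p.285, (81)–(83) p.290; [Balaban1988Convergent]
CMP 119 (1988) 243–285, (2.2) p.255, (2.11)–(2.14) pp.256–257.
-/

noncomputable section

open Set Finset Metric Filter
open scoped BigOperators Matrix RealInnerProductSpace Real InnerProductSpace Topology Matrix.Norms.L2Operator

namespace Summit.QuantumFields.YangMills.BalabanUVNodes.N12Prop1DirectOfChartHalfOfClassRowL1Explicit

open Literature.MathematicalPhysics.QuantumFieldTheory.Balaban1983to89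
open T4Continuum B15DeterminingSets GaugeField B16Sect1Backgrounds B15Prop1Carrier B8Eq17ClassAkV1 BlockAveraging
open B15Prop1SliceTaylorCalculus
open B15Prop1ChartCalculusSU2 (E3)
open T4CubeChartGnomonic (SU2)
open B15Prop1ChartSU2 (su2Chart)
open B15Prop1SliceCoordinates (GaugeSlice ιA freeBonds)
open B15Prop1AnalyticExtClause (cplxVec anExt)
open T4AdjointCovarianceUnitary (lieSU)
open T4AxialGaugeSmallField (castSite boxPlaqs boxBonds)
open B6BondElimination (unitVec)
open B6TreeGaugePoincare (curl)
open B16Eq18Proof (box mem_box)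
open B15Extension193 (extend)
open B15ShellGauge193 (shellGauge)
open B14.Eq213MaximalDomains (side)
open B14.Eq213DetSet B14.Eq216Concrete B15Sect1Instances B15Eq177GaugeInvariance B15Eq177ValueInvariance B15Eq177ValueInvarianceCoDiv B16Sect1Wilson
open B14.Eq22Determines (blockIter IsBlockUnion)
open Literature.MathematicalPhysics.QuantumFieldTheory.BalabanImbrieJaffe1984to88.BIJ85Eq453GaugeField
open Node00 (expChart msChart constrCard)
open B15Prop1WindowDirectPackageFromLetters (exists_domain_prop1Printed_lfVarOn_std_su2_box_intrinsic_analytic_atZSeqCoPRecord_ofThm1TorusClass_ofMinimiserFamily_ofWindowLetters_ofCoercive)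
open Node00 (avOfRecord regMSCoPOfRecord constrEnum)
open B15Prop1NumericsThresholds (hsm_direct_of_le_explicitThreshold)
open Summit.QuantumFields.YangMills.BalabanUVNodes.N12NearFlatChartLetter (l2Seminorm_le_of_bound_of_support l2Seminorm_apply)

variable {F : T4Family}
set_option maxHeartbeats 400000 in
/-- ★★★ **(P2c)‴ `(iii)_direct`, EXPLICIT-THRESHOLD FRAME, CHART HALF IN PER-ROW ℓ¹ CURRENCY** — (P2c)″ (p680717) with its chart-half letter `hhalf` swapped for the ∀-body of dag-n12-c
g22's ρ6b `exists_hWD_chartHalf_of_class_uniform_rowl1_family` (FIVE constants `C ρ Kτ ρτ ρ5` as binders; the right inverse `H` witnesses surjectivity only, its size enters through the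
PER-ROW ℓ¹ PREIMAGE LETTER at `B₁`, the curvature through the ℓ¹-CURVATURE LETTER, (μ) constant `2(d−1)·εP·B₁·M₂`), the (P4)′ socket `hH` displayed as `∃ H, hHinv ∧ per-row letter at B₁ i`,
the (P5) letter `hM₂` as the
ℓ¹-curvature letter at `M₂ i`, and the threshold's (μ)-term `2(d−1)·B₁ i·M₂ i` (NO `√#PBond`).  Same frame `∀ δ, (∀ i, 0 < δ i) → (∀ i, δ i ≤ Θ i) → ∀ (hσW) (hPχ), ∃ a₁ > 0, Prop1Printed …`.
ρ6b's ℓ² velocity letter `hK2` is inhabited in-proof at `K₂ := 12·𝓐₀ i∕R i·√#{b ∕∕ b.src ∈ Ω₁(Z_i)}` (so `Θ`'s `Kc_i` is unchanged).  Proof: (P2c)″'s verbatim with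
`μc := 2(d−1)·δ i·B₁ i·M₂ i`.  (`maxHeartbeats 400000`: as (P2c)″.)
[cite: Balaban1989LargeFieldI, (1.74) p.192, Prop. 1 (1.77)–(1.78) p.194, (1.79) p.195; Balaban1989LargeFieldII, p.357, (1.7)–(1.9) p.358, (1.12)–(1.13) p.359; Balaban1985Variational, (2)–(4) p.278, Thm 1 (8) p.279, (44)–(48) p.285, (81)–(83) p.290; Balaban1988Convergent, (2.2) p.255, (2.11)–(2.14) pp.256–257] -/
theorem exists_domain_prop1Printed_lfVarOn_std_su2_box_intrinsic_analytic_atZSeqCoPRecord_ofThm1TorusClass_ofMinimiserFamily_ofWindowGaugeLetter_ofChartHalfOfClassRowL1_explicit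
    (ν : Node00.Stage7Numerics) (Kt : ℕ) (hd3 : 3 ≤ (F.P Kt).d) (h0 : 0 < (F.P Kt).d) {ι : Type}
    (Z Λ : ι → Set (Site (F.P Kt) 0)) (k : ι → ℕ) (M : ι → ℝ) (hk0 : ∀ i, 0 < k i) (hk1 : ∀ i, k i + 1 ≤ (F.P Kt).m + (F.P Kt).K)
    (eR : ι → ℝ) (heR : ∀ i, 0 < eR i)
    (T : ∀ i, Finset (PBond (F.P Kt) (k i)))
    (lo hi : ι → Fin (F.P Kt).d → ℤ) (n : ι → ℕ) (hn : ∀ i κ, hi i κ ≤ lo i κ + n i) (hN : ∀ i, n i + 2 < (F.P Kt).sitesPerDir (k i))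
    (hbox : ∀ i, pts (k i) (Λ i) = (castSite '' Set.Icc (lo i) (hi i) : Set (Site (F.P Kt) (k i))))
    (hZ : ∀ i, (boxPlaqs (lo i - 1) (hi i + 1) : Set (Plaq (F.P Kt) (k i))) ⊆ plaqsInside (pts (k i) (Z i)))
    (hTG0 : ∀ i, T i = (box (fun κ => (hi i κ - lo i κ + 1).toNat) (lo i)).image fun x =>
      (⟨castSite (x - unitVec ⟨0, h0⟩), ⟨0, h0⟩⟩ : PBond (F.P Kt) (k i)))
    (hN5 : ∀ i κ, ((hi i κ - lo i κ + 1).toNat : ℤ) + 5 < (F.P Kt).sitesPerDir (k i))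
    (K : ι → ℕ) (hK1 : ∀ i, 1 ≤ K i) (hKn : ∀ i κ, (hi i κ - lo i κ + 1).toNat ≤ K i)
    (ext : ∀ i, GaugeField (F.P Kt) (k i) SU2 → GaugeField (F.P Kt) (k i) SU2)
    (hext : ∀ i Vk, ext i Vk = extend (pts (k i) (Λ i)) (shellGauge Vk (lo i) (hi i)) Vk)
    (hlohi : ∀ i, lo i ≤ hi i)
    -- the REGION parallelepipeds of the normalisation and the datum tolerances
    (LO HI : ι → Fin (F.P Kt).d → ℤ) (hLO : ∀ i, LO i ≤ lo i - 1) (hHI : ∀ i, hi i + 1 ≤ HI i) (n' : ι → ℕ) (hn' : ∀ i κ, HI i κ ≤ LO i κ + n' i)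
    (hn'N : ∀ i, n' i < (F.P Kt).sitesPerDir (k i)) (hR' : ∀ i, (boxPlaqs (LO i) (HI i) : Set (Plaq (F.P Kt) (k i))) ⊆ plaqsInside (pts (k i) (Z i)))
    (ρn : ι → ℝ)
    (hρn : ∀ i, (((F.P Kt).d : ℝ) * n' i + 1) * ((((F.P Kt).d - 1 : ℕ) : ℝ) * n' i * ((12 * (F.P Kt).d * (n i + 2) ^ 2 + 1) * eR i)
      + 3 * (F.P Kt).d * (n i + 2) ^ 2 * eR i) ≤ ρn i)
    {γ cJ bx : ℝ} (hγ : 0 < γ) (hcJ : 0 ≤ cJ) (hbx : 0 ≤ bx)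
    (hbxM : ∀ i, 12 * ((F.P Kt).d : ℝ) * ((n i : ℝ) + 2) ^ 2 ≤ bx * (M i) ^ 2)
    {R 𝓐₀ : ι → ℝ} (hM : ∀ i, 1 ≤ (M i)) (hR : ∀ i, 0 < R i) (h𝓐₀ : ∀ i, 0 ≤ 𝓐₀ i)
    -- (J0′), R-EXPLICIT: per instance one radius and one bound for every base field of the strict guard
    (hMin : ∀ i Vk, PlaqSmallOn (plaqsInside (pts (k i) (Z i ∩ (Λ i)ᶜ))) (eR i) Vk →
      ∃ Ũ : VecField (F.P Kt) (k i) (EuclideanSpace ℂ (Fin 3)) × VecField (F.P Kt) (k i) (EuclideanSpace ℂ (Fin 3)) →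
          PBond (F.P Kt) 0 → Matrix (Fin 2) (Fin 2) ℂ,
        (∀ b a c, DifferentiableOn ℂ (fun z => Ũ z b a c) (ball 0 (R i))) ∧
        (∀ z ∈ ball (0 : VecField (F.P Kt) (k i) (EuclideanSpace ℂ (Fin 3)) × VecField (F.P Kt) (k i) (EuclideanSpace ℂ (Fin 3))) (R i),
          ∀ b a c, ‖Ũ z b a c‖ ≤ 𝓐₀ i) ∧
        ∀ p B' : VecField (F.P Kt) (k i) E3, ‖p‖ < R i → ‖B'‖ < R i → ∃ U' : GaugeField (F.P Kt) 0 SU2,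
          (∀ b, Ũ (cplxVec p, cplxVec B') b = ((U' b : SU2) : Matrix (Fin 2) (Fin 2) ℂ)) ∧
            IsMinimizer (Node00.avOfRecord F 2 Kt) (Node00.regMSCoPOfRecord F 2 ν Kt (k i) (maxDomT ν.M₁ (Z i))) (Bj ν.M₁ (Z i) (k i))
              (avgFamily (Node00.avOfRecord F 2 Kt) (qsstarGIter0 (k i) (expMul su2Chart B' (ext i (expMul su2Chart p Vk))))) U')
    -- dag-n12-w4's GEOMETRY letter of the chart file (the window box and its two shifts inside `Ω_k(Z)`)
    (hΩw : ∀ i, ∀ (ν' : Fin (F.P Kt).d), ∀ z ∈ box (fun κ => (hi i κ - lo i κ + 1).toNat + 3) (fun κ => lo i κ - 2),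
      (castSite z : Site (F.P Kt) (k i)) ∈ pts (k i) (maxDomT ν.M₁ (Z i) (k i)) ∧
        (castSite z : Site (F.P Kt) (k i)).shift ⟨0, h0⟩ ∈ pts (k i) (maxDomT ν.M₁ (Z i) (k i)) ∧
        (castSite z : Site (F.P Kt) (k i)).shift ν' ∈ pts (k i) (maxDomT ν.M₁ (Z i) (k i)))
    -- the WINDOW per instance, containing every plaquette whose source lies in the fine image of the enlarged window box (the chart half's `hW`)
    (W : ι → Finset (Plaq (F.P Kt) 0))
    (hWbox : ∀ i, ∀ q : Plaq (F.P Kt) 0, q.src ∈ ((box (fun κ => (F.P Kt).L ^ (k i) * ((hi i κ - lo i κ + 1).toNat + 3 + 1) - 1) (fun κ => ((F.P Kt).L : ℤ) ^ (k i) * (lo i κ - 2))).image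
        (fun z => (castSite z : Site (F.P Kt) 0))) → q ∈ W i)
    -- THE CHART HALF, DISPLAYED, `hsb`-FREE AND IN ℓ¹-LETTER CURRENCY (LOCATED-FLOOR + LOCATED-HSB + census U2b): FIVE per-height constants as BINDERS and ONE letter = the ∀-body of
    -- dag-n12-c g22's ρ6b `N12DirectChartPackageOfClassRowL1Family.exists_hWD_chartHalf_of_class_uniform_rowl1_family` at height `k i` (the right inverse `H` witnesses surjectivity only;
    -- its size enters through the PER-ROW ℓ¹ PREIMAGE LETTER at `B₁`, the curvature through the ℓ¹-curvature letter at `M₂`; (μ) constant `2(d−1)·εP·B₁·M₂` — NO torus bond count)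
    (C ρ Kτ ρτ ρ5 : ι → ℝ) (hρ : ∀ i, 0 < ρ i) (hKτ : ∀ i, 0 ≤ Kτ i) (hρτ : ∀ i, 0 < ρτ i)
    (hhalf : ∀ i,
        ∀ (ν : Node00.Stage7Numerics) (Z Λ : Set (Site (F.P Kt) 0)) (T : Finset (PBond (F.P Kt) (k i))) (lo hi : Fin (F.P Kt).d → ℤ),
        (∀ κ, ((((hi κ - lo κ + 1).toNat + 3 : ℕ) : ℤ)) ≤ (F.P Kt).sitesPerDir (k i)) →
        (∀ (ν' : Fin (F.P Kt).d), ∀ z ∈ box (fun κ => (hi κ - lo κ + 1).toNat + 3) (fun κ => lo κ - 2),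
          (castSite z : Site (F.P Kt) (k i)) ∈ pts (k i) (maxDomT ν.M₁ Z (k i)) ∧ (castSite z : Site (F.P Kt) (k i)).shift ⟨0, h0⟩ ∈ pts (k i) (maxDomT ν.M₁ Z (k i)) ∧
            (castSite z : Site (F.P Kt) (k i)).shift ν' ∈ pts (k i) (maxDomT ν.M₁ Z (k i))) →
        (k i) + 1 ≤ (F.P Kt).m + (F.P Kt).K → 4 * (F.P Kt).L ≤ ν.M₁ → side (F.P Kt).L ν.M₁ (k i) ∣ (F.P Kt).sitesPerDir 0 → 0 ≤ ν.εreg →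
        6 * ((((F.P Kt).d - 1 : ℕ)) : ℝ) * (F.P Kt).L * ν.εreg ≤ ρ5 i →
        ∀ (ext : GaugeField (F.P Kt) (k i) SU2 → GaugeField (F.P Kt) (k i) SU2) (Vk : GaugeField (F.P Kt) (k i) SU2),
        ∀ (U₀ : GaugeField (F.P Kt) 0 SU2) (Xf : GaugeSlice (pts (k i) Λ) T E3 → PBond (F.P Kt) 0 → lieSU (Fin 2)),
        IsMinimizer (Node00.avOfRecord F 2 Kt) (Node00.regMSCoPOfRecord F 2 ν Kt (k i) (maxDomT ν.M₁ Z)) (Bj ν.M₁ Z (k i))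
          (avgFamily (Node00.avOfRecord F 2 Kt) (qsstarGIter0 (k i) (ext Vk))) U₀ →
        ∀ ⦃εP : ℝ⦄, 0 ≤ εP →
        (∀ p : Plaq (F.P Kt) 0, ((⟨p.src, p.μ⟩ : PBond (F.P Kt) 0) ∈ {b : PBond (F.P Kt) 0 | b.src ∈ maxDomT ν.M₁ Z 1} ∨
            (⟨p.src.shift p.μ, p.ν⟩ : PBond (F.P Kt) 0) ∈ {b : PBond (F.P Kt) 0 | b.src ∈ maxDomT ν.M₁ Z 1} ∨
            (⟨p.src.shift p.ν, p.μ⟩ : PBond (F.P Kt) 0) ∈ {b : PBond (F.P Kt) 0 | b.src ∈ maxDomT ν.M₁ Z 1} ∨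
            (⟨p.src, p.ν⟩ : PBond (F.P Kt) 0) ∈ {b : PBond (F.P Kt) 0 | b.src ∈ maxDomT ν.M₁ Z 1}) →
          ‖((GaugeField.plaqHol U₀ p : SU2) : Matrix (Fin 2) (Fin 2) ℂ) - 1‖ ≤ εP) →
        ∀ (H : (Fin (constrCard (Bj ν.M₁ Z (k i)) (k i)) → lieSU (Fin 2)) → PBond (F.P Kt) 0 → lieSU (Fin 2)),
        (∀ v, fderiv ℝ (msChart F 2 Kt (k i) (Bj ν.M₁ Z (k i)) (avgFamily (avOfRecord F 2 Kt) (qsstarGIter0 (k i) (ext Vk))) U₀) 0 (H v) = v) →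
        ∀ ⦃B₁ : ℝ⦄, 0 ≤ B₁ →
        (∀ i' : Fin (constrCard (Bj ν.M₁ Z (k i)) (k i)), 1 ≤ ((((constrEnum (Bj ν.M₁ Z (k i)) (k i)).symm i').1 : ℕ)) → ∀ ξ : lieSU (Fin 2),
          ∃ x : PBond (F.P Kt) 0 → lieSU (Fin 2), fderiv ℝ (msChart F 2 Kt (k i) (Bj ν.M₁ Z (k i)) (avgFamily (avOfRecord F 2 Kt) (qsstarGIter0 (k i) (ext Vk))) U₀) 0 x = Pi.single i' ξ ∧
            ∑ b, ‖(x b : Matrix (Fin 2) (Fin 2) ℂ)‖ ≤ B₁ * ‖ξ‖) →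
        ∀ ⦃M₂ : ℝ⦄, (∀ w, ∑ c, ‖fderiv ℝ (fderiv ℝ (msChart F 2 Kt (k i) (Bj ν.M₁ Z (k i)) (avgFamily (avOfRecord F 2 Kt) (qsstarGIter0 (k i) (ext Vk))) U₀)) 0 w w c‖ ≤ M₂ * ∑ b, ‖w b‖ ^ 2) →
        Xf 0 = 0 → ContDiffAt ℝ 2 Xf 0 →
        (∀ᶠ Y in 𝓝 (0 : GaugeSlice (pts (k i) Λ) T E3),
          IsMinimizer (Node00.avOfRecord F 2 Kt) (Node00.regMSCoPOfRecord F 2 ν Kt (k i) (maxDomT ν.M₁ Z)) (Bj ν.M₁ Z (k i))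
            (avgFamily (Node00.avOfRecord F 2 Kt) (qsstarGIter0 (k i) (expMul su2Chart (ιA (pts (k i) Λ) T Y) (ext Vk)))) (expChart U₀ (Xf Y))) →
        ∀ ⦃K₂ : ℝ⦄, (∀ X : GaugeSlice (pts (k i) Λ) T E3, Real.sqrt (∑ b, ‖fderiv ℝ Xf 0 X b‖ ^ 2) ≤ K₂ * ‖X‖) →
        ∀ (W : Finset (Plaq (F.P Kt) 0)),
        (∀ q : Plaq (F.P Kt) 0, q.src ∈ ((box (fun κ => (F.P Kt).L ^ (k i) * ((hi κ - lo κ + 1).toNat + 3 + 1) - 1) (fun κ => ((F.P Kt).L : ℤ) ^ (k i) * (lo κ - 2))).image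
            (fun z => (castSite z : Site (F.P Kt) 0))) → q ∈ W) →
        ∀ ⦃δW : ℝ⦄, 0 < δW → δW < ρ i → δW < ρτ i →
        (∀ (ν' : Fin (F.P Kt).d), ∀ z ∈ box (fun κ => (hi κ - lo κ + 1).toNat + 3) (fun κ => lo κ - 2), ∀ b₀ : PBond (F.P Kt) 0,
          (b₀ ∈ feeds (k i) (⟨(castSite z : Site (F.P Kt) (k i)), ⟨0, h0⟩⟩ : PBond (F.P Kt) (k i)) ∨ b₀ ∈ feeds (k i) (⟨((castSite z : Site (F.P Kt) (k i))).shift ⟨0, h0⟩, ν'⟩ : PBond (F.P Kt) (k i))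
          ∨ b₀ ∈ feeds (k i) (⟨((castSite z : Site (F.P Kt) (k i))).shift ν', ⟨0, h0⟩⟩ : PBond (F.P Kt) (k i)) ∨ b₀ ∈ feeds (k i) (⟨(castSite z : Site (F.P Kt) (k i)), ν'⟩ : PBond (F.P Kt) (k i))) →
          ‖((U₀ b₀ : SU2) : Matrix (Fin 2) (Fin 2) ℂ) - 1‖ ≤ δW) →
        ∃ (Ψ₂ : (PBond (F.P Kt) 0 → lieSU (Fin 2)) →L[ℝ] (PBond (F.P Kt) 0 → lieSU (Fin 2)) →L[ℝ] (Fin (constrCard (Bj ν.M₁ Z (k i)) (k i)) → lieSU (Fin 2)))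
          (lam : (Fin (constrCard (Bj ν.M₁ Z (k i)) (k i)) → lieSU (Fin 2)) →L[ℝ] ℝ)
          (p : Seminorm ℝ (PBond (F.P Kt) 0 → lieSU (Fin 2))),
          HasFDerivAt (fun Y => fderiv ℝ (msChart F 2 Kt (k i) (Bj ν.M₁ Z (k i)) (avgFamily (avOfRecord F 2 Kt) (qsstarGIter0 (k i) (ext Vk))) U₀) Y) Ψ₂ 0 ∧
          (∀ᶠ Y in 𝓝 (0 : PBond (F.P Kt) 0 → lieSU (Fin 2)), DifferentiableAt ℝ (msChart F 2 Kt (k i) (Bj ν.M₁ Z (k i)) (avgFamily (avOfRecord F 2 Kt) (qsstarGIter0 (k i) (ext Vk))) U₀) Y) ∧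
          fderiv ℝ (fun Y : PBond (F.P Kt) 0 → lieSU (Fin 2) => wilsonAction4 (expChart U₀ Y)) 0 = lam.comp (fderiv ℝ (msChart F 2 Kt (k i) (Bj ν.M₁ Z (k i)) (avgFamily (avOfRecord F 2 Kt) (qsstarGIter0 (k i) (ext Vk))) U₀) 0) ∧
          (∀ Y : PBond (F.P Kt) 0 → lieSU (Fin 2), ∑ b, ‖(Y b : Matrix (Fin 2) (Fin 2) ℂ)‖ ^ 2 ≤ p Y ^ 2) ∧
          ∀ X : GaugeSlice (pts (k i) Λ) T E3,
            lam (Ψ₂ (fderiv ℝ Xf 0 X) (fderiv ℝ Xf 0 X))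
                ≤ (2 * (((F.P Kt).d : ℝ) - 1) * εP * B₁ * M₂) * p (fderiv ℝ Xf 0 X) ^ 2 ∧
            p (fderiv ℝ Xf 0 X) ≤ K₂ * ‖X‖ ∧
            (((F.P Kt).L : ℝ) ^ (F.P Kt).d) ^ (k i) / ((((F.P Kt).L : ℝ)) ^ 2 * ((F.P Kt).L : ℝ) ^ 2) ^ (k i) / 2 * (∑ z ∈ box (fun κ => (hi κ - lo κ + 1).toNat + 3) (fun κ => lo κ - 2), ∑ μ : Fin (F.P Kt).d, ∑ a : Fin 3, curl (fun b => ιA (pts (k i) Λ) T X (⟨castSite b.1, b.2⟩ : PBond (F.P Kt) (k i)) a) z ⟨0, h0⟩ μ ^ 2)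
                - (((F.P Kt).L : ℝ) ^ (F.P Kt).d) ^ (k i) / ((((F.P Kt).L : ℝ)) ^ 2 * ((F.P Kt).L : ℝ) ^ 2) ^ (k i) * (8 * (((F.P Kt).d : ℝ) + 1) * (2 * ((Kτ i) + 1) * δW) + 8 * ((F.P Kt).d : ℝ) * (((box (fun κ => (hi κ - lo κ + 1).toNat + 3) (fun κ => lo κ - 2)).image (fun z => (castSite z : Site (F.P Kt) (k i)))).card : ℝ) * ((C i) * δW * K₂) ^ 2) * ‖X‖ ^ 2
              ≤ ((Fintype.card (Fin 2) : ℝ)⁻¹ • ∑ p ∈ W, (innerSL ℝ (E := lieSU (Fin 2))).bilinearComp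
                (ContinuousLinearMap.proj (R := ℝ) (φ := fun _ : PBond (F.P Kt) 0 => lieSU (Fin 2)) (⟨p.src, p.μ⟩ : PBond (F.P Kt) 0) + ContinuousLinearMap.proj (R := ℝ) (φ := fun _ : PBond (F.P Kt) 0 => lieSU (Fin 2)) (⟨p.src.shift p.μ, p.ν⟩ : PBond (F.P Kt) 0)
                  - ContinuousLinearMap.proj (R := ℝ) (φ := fun _ : PBond (F.P Kt) 0 => lieSU (Fin 2)) (⟨p.src.shift p.ν, p.μ⟩ : PBond (F.P Kt) 0) - ContinuousLinearMap.proj (R := ℝ) (φ := fun _ : PBond (F.P Kt) 0 => lieSU (Fin 2)) (⟨p.src, p.ν⟩ : PBond (F.P Kt) 0) : (PBond (F.P Kt) 0 → lieSU (Fin 2)) →L[ℝ] lieSU (Fin 2))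
                (ContinuousLinearMap.proj (R := ℝ) (φ := fun _ : PBond (F.P Kt) 0 => lieSU (Fin 2)) (⟨p.src, p.μ⟩ : PBond (F.P Kt) 0) + ContinuousLinearMap.proj (R := ℝ) (φ := fun _ : PBond (F.P Kt) 0 => lieSU (Fin 2)) (⟨p.src.shift p.μ, p.ν⟩ : PBond (F.P Kt) 0)
                  - ContinuousLinearMap.proj (R := ℝ) (φ := fun _ : PBond (F.P Kt) 0 => lieSU (Fin 2)) (⟨p.src.shift p.ν, p.μ⟩ : PBond (F.P Kt) 0) - ContinuousLinearMap.proj (R := ℝ) (φ := fun _ : PBond (F.P Kt) 0 => lieSU (Fin 2)) (⟨p.src, p.ν⟩ : PBond (F.P Kt) 0) : (PBond (F.P Kt) 0 → lieSU (Fin 2)) →L[ℝ] lieSU (Fin 2))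
                : (PBond (F.P Kt) 0 → lieSU (Fin 2)) →L[ℝ] (PBond (F.P Kt) 0 → lieSU (Fin 2)) →L[ℝ] ℝ) (fderiv ℝ Xf 0 X) (fderiv ℝ Xf 0 X))
    -- the `hsb`-free letter's numeric premises displayed: radius row, the class threshold positive, and its floor against the per-height curvature radius `ρ5`
    (hM4 : 4 * (F.P Kt).L ≤ ν.M₁) (hεreg : 0 < ν.εreg) (hερ : ∀ i, 6 * ((((F.P Kt).d - 1 : ℕ)) : ℝ) * (F.P Kt).L * ν.εreg ≤ ρ5 i)
    -- the (P4)′ constant (ℓ¹ → ℓ¹ currency) and the chart-curvature constant (P5, ℓ¹ currency), per instance, chosen BEFORE the base field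
    (B₁ M₂ : ι → ℝ) (hB1 : ∀ i, 0 ≤ B₁ i) (hM₂0 : ∀ i, 0 ≤ M₂ i)
    -- DISPLAYED per guarded base field ∕ minimiser: the (P4)′ socket in ρ6b's currency (a right inverse `H` witnessing surjectivity + the PER-ROW ℓ¹ PREIMAGE LETTER at `B₁ i`: every
    -- positive-level one-row datum `e_{i'} ξ` has a `DΨ(0)`-preimage of ℓ¹ size `≤ B₁ i·‖ξ‖`) and the ℓ¹-CURVATURE letter (P5) at `M₂ i` — both discharged from the class downstream ((D1)⁵)
    (hH : ∀ i (Vk : GaugeField (F.P Kt) (k i) SU2), PlaqSmallOn (plaqsInside (pts (k i) (Z i ∩ (Λ i)ᶜ))) (eR i) Vk →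
      (∀ b ∈ (boxBonds (LO i) (HI i) : Set (PBond (F.P Kt) (k i))), dist1 (ext i Vk b) ≤ ρn i) →
      ∀ U₀ : GaugeField (F.P Kt) 0 SU2,
        IsMinimizer (Node00.avOfRecord F 2 Kt) (Node00.regMSCoPOfRecord F 2 ν Kt (k i) (maxDomT ν.M₁ (Z i))) (Bj ν.M₁ (Z i) (k i))
          (avgFamily (Node00.avOfRecord F 2 Kt) (qsstarGIter0 (k i) (ext i Vk))) U₀ →
        ∃ H : (Fin (constrCard (Bj ν.M₁ (Z i) (k i)) (k i)) → lieSU (Fin 2)) → PBond (F.P Kt) 0 → lieSU (Fin 2),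
          (∀ v, fderiv ℝ (msChart F 2 Kt (k i) (Bj ν.M₁ (Z i) (k i)) (avgFamily (Node00.avOfRecord F 2 Kt) (qsstarGIter0 (k i) (ext i Vk))) U₀) 0 (H v) = v) ∧
          (∀ i' : Fin (constrCard (Bj ν.M₁ (Z i) (k i)) (k i)), 1 ≤ ((((constrEnum (Bj ν.M₁ (Z i) (k i)) (k i)).symm i').1 : ℕ)) → ∀ ξ : lieSU (Fin 2),
            ∃ x : PBond (F.P Kt) 0 → lieSU (Fin 2), fderiv ℝ (msChart F 2 Kt (k i) (Bj ν.M₁ (Z i) (k i)) (avgFamily (Node00.avOfRecord F 2 Kt) (qsstarGIter0 (k i) (ext i Vk))) U₀) 0 x = Pi.single i' ξ ∧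
              ∑ b, ‖(x b : Matrix (Fin 2) (Fin 2) ℂ)‖ ≤ B₁ i * ‖ξ‖))
    (hM₂ : ∀ i (Vk : GaugeField (F.P Kt) (k i) SU2), PlaqSmallOn (plaqsInside (pts (k i) (Z i ∩ (Λ i)ᶜ))) (eR i) Vk →
      (∀ b ∈ (boxBonds (LO i) (HI i) : Set (PBond (F.P Kt) (k i))), dist1 (ext i Vk b) ≤ ρn i) →
      ∀ U₀ : GaugeField (F.P Kt) 0 SU2,
        IsMinimizer (Node00.avOfRecord F 2 Kt) (Node00.regMSCoPOfRecord F 2 ν Kt (k i) (maxDomT ν.M₁ (Z i))) (Bj ν.M₁ (Z i) (k i))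
          (avgFamily (Node00.avOfRecord F 2 Kt) (qsstarGIter0 (k i) (ext i Vk))) U₀ →
        ∀ w, ∑ c, ‖fderiv ℝ (fderiv ℝ (msChart F 2 Kt (k i) (Bj ν.M₁ (Z i) (k i)) (avgFamily (Node00.avOfRecord F 2 Kt) (qsstarGIter0 (k i) (ext i Vk))) U₀)) 0 w w c‖ ≤ M₂ i * ∑ b, ‖w b‖ ^ 2)
    -- numerics: the positivity constant fits (`γ₀ := 1∕2`: the chart half's level factor `((L^d)^k∕(L²·L²)^k)∕2` at `d = 4`)
    (hγle : ∀ i, γ / (M i) ^ 5 ≤ 1 / 2 / (2 * (3 * (K i : ℝ) ^ 2 + 2 * (K i : ℝ) ^ 4)))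
    (hfar : ∀ i (b : PBond (F.P Kt) 0), b.src ∉ maxDomT ν.M₁ (Z i) 1 →
      (⟨blockIter (k i) b.src, b.dir⟩ : PBond (F.P Kt) (k i)) ∉ bondsOf (pts (k i) (Λ i)))
    (hZblk : ∀ i, IsBlockUnion (k i) (Z i))
    (hM2 : 2 ≤ ν.M₁) (hdiv : ∀ i, side (F.P Kt).L ν.M₁ (k i) ∣ (F.P Kt).sitesPerDir 0)
    {cE B₃ a₀ a₁' cA : ℝ} (hcE0 : 0 ≤ cE) (hcE : ∀ i, 12 * ((F.P Kt).d : ℝ) * ((n i : ℝ) + 2) ^ 2 ≤ cE) (hB₃ : 0 ≤ B₃)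
    (heRa : ∀ i, (cE + 1) * eR i ≤ a₁' ∧ B₃ * ((cE + 1) * eR i) ≤ ν.εreg) (ha₀ : ν.εreg ≤ a₀)
    (hcA : 1 / 2 * (B₃ * (cE + 1) * (F.P Kt).eta 1 ^ 2) ^ 2 * (Fintype.card (Plaq (F.P Kt) 0) : ℝ) ≤ cA)
    (h15T : ∀ (k' : ℕ), k' ≤ (F.P Kt).m + (F.P Kt).K → side (F.P Kt).L ν.M₁ k' ∣ (F.P Kt).sitesPerDir 0 →
      ∀ (s : B14.Eq218Concrete.Seq (fun n : ℕ => Node00.unionsOfCubes (F.P Kt) (side (F.P Kt).L ν.M₁ n)) k'),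
      Node00.Sect2.SeqSeparated ν.M₁ s → 0 < ν.M₁ →
      ∀ (ε₀ : ℝ) (δ : ℕ → ℝ), (∀ j, j ≤ k' → 0 < δ j ∧ δ j ≤ a₁' ∧ B₃ * δ j ≤ ε₀) → (∀ j, j < k' → δ j ≤ 2 * δ (j + 1)) →
      (∀ j, j < k' → δ (j + 1) ≤ 2 * δ j) → ε₀ ≤ a₀ →
      ∀ W : MSField (F.P Kt) SU2,
        Node00.Sect2.DataSmall7PTop (Node00.avOfRecord F 2 Kt) s.Ω (Node00.suppDomOfRecord F ν Kt s.Ω) k' δ W →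
        ∀ U₀ : GaugeField (F.P Kt) 0 SU2, IsMinimizer (Node00.avOfRecord F 2 Kt)
            {U | (∀ j, j ≤ k' → PlaqSmallOn (Node00.Sect2.omegaPlaqsTop s.Ω (Node00.suppDomOfRecord F ν Kt s.Ω) j)
                (ε₀ * (F.P Kt).eta j ^ 2) U) ∧
              Node00.Sect2.CoDivClassOnTop s.Ω (Node00.suppDomOfRecord F ν Kt s.Ω) k' ε₀ U}
            (genSet s.Ω k') W U₀ →
          (∀ j, j ≤ k' → PlaqSmallOn (Node00.Sect2.omegaPlaqsTop s.Ω (Node00.suppDomOfRecord F ν Kt s.Ω) j)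
              (B₃ * δ j * (F.P Kt).eta j ^ 2) U₀) ∧
            ∀ j, j ≤ k' → Node00.Sect2.CoDivSmallOn (Node00.Sect2.omegaBondsTop s.Ω (Node00.suppDomOfRecord F ν Kt s.Ω) j)
              (B₃ * δ j * (F.P Kt).eta j ^ 3) U₀)
    (hcJ' : ∀ i, 2 * cA * eR i / R i + 4 * ((Fintype.card (Plaq (F.P Kt) 0) : ℝ) * (1 + 8 * 𝓐₀ i ^ 4)) / (R i * eR i) ≤ cJ)
    -- THE EXPLICIT-THRESHOLD FRAME (no `∃ δ₀`): tolerances below `Θ i := min (min (ρ i) (ρτ i) ∕ 2) (min 1 (rhs_i ∕ (max S_i 0 + 1)))`, every symbol a binder or a cardinality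
    : ∀ δ : ι → ℝ, (∀ i, 0 < δ i) →
      (∀ i, δ i ≤ min (min (ρ i) (ρτ i) / 2)
        (min 1 (1 / 2 / (2 * (3 * (K i : ℝ) ^ 2 + 2 * (K i : ℝ) ^ 4)) /
          (max ((32 * (((F.P Kt).d : ℝ) - 1) + 8 * (((F.P Kt).d : ℝ) - 1) + (2 * (((F.P Kt).d : ℝ) - 1) * B₁ i * M₂ i)) * (12 * 𝓐₀ i / R i * Real.sqrt (Nat.card {b : PBond (F.P Kt) 0 // b.src ∈ maxDomT ν.M₁ (Z i) 1})) ^ 2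
            + (8 * (((F.P Kt).d : ℝ) + 1) * (2 * (Kτ i + 1)) + 8 * ((F.P Kt).d : ℝ) * (((box (fun κ => (hi i κ - lo i κ + 1).toNat + 3) (fun κ => lo i κ - 2)).image (fun z => (castSite z : Site (F.P Kt) (k i)))).card : ℝ) * (C i * (12 * 𝓐₀ i / R i * Real.sqrt (Nat.card {b : PBond (F.P Kt) 0 // b.src ∈ maxDomT ν.M₁ (Z i) 1}))) ^ 2)) 0 + 1)))) →
      -- (σ)_W THE WINDOW GAUGE LETTER at tolerance `δ i` on the window's plaquette bonds and on the feeds (dag-n12-c's §2 text at `δc = δW := δ i`)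
      ∀ (hσW : ∀ i (Vk : GaugeField (F.P Kt) (k i) SU2), PlaqSmallOn (plaqsInside (pts (k i) (Z i ∩ (Λ i)ᶜ))) (eR i) Vk →
      (∀ b ∈ (boxBonds (LO i) (HI i) : Set (PBond (F.P Kt) (k i))), dist1 (ext i Vk b) ≤ ρn i) →
      ∀ U₀ : GaugeField (F.P Kt) 0 SU2,
        IsMinimizer (Node00.avOfRecord F 2 Kt) (Node00.regMSCoPOfRecord F 2 ν Kt (k i) (maxDomT ν.M₁ (Z i))) (Bj ν.M₁ (Z i) (k i))
          (avgFamily (Node00.avOfRecord F 2 Kt) (qsstarGIter0 (k i) (ext i Vk))) U₀ →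
        ∃ σ : GaugeTransf (F.P Kt) 0 SU2,
          (∀ j, j ≤ k i → ∀ b ∈ bondsOf (Bj ν.M₁ (Z i) (k i) j), toMS σ j b.src = 1 ∧ toMS σ j b.tgt = 1) ∧
          (∀ p ∈ W i, ‖((gaugeAct σ U₀ ⟨p.src, p.μ⟩ : SU2) : Matrix (Fin 2) (Fin 2) ℂ) - 1‖ ≤ δ i ∧ ‖((gaugeAct σ U₀ ⟨p.src.shift p.μ, p.ν⟩ : SU2) : Matrix (Fin 2) (Fin 2) ℂ) - 1‖ ≤ δ i ∧
            ‖((gaugeAct σ U₀ ⟨p.src.shift p.ν, p.μ⟩ : SU2) : Matrix (Fin 2) (Fin 2) ℂ) - 1‖ ≤ δ i ∧ ‖((gaugeAct σ U₀ ⟨p.src, p.ν⟩ : SU2) : Matrix (Fin 2) (Fin 2) ℂ) - 1‖ ≤ δ i) ∧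
          (∀ (ν' : Fin (F.P Kt).d), ∀ z ∈ box (fun κ => (hi i κ - lo i κ + 1).toNat + 3) (fun κ => lo i κ - 2), ∀ b₀ : PBond (F.P Kt) 0,
            (b₀ ∈ feeds (k i) (⟨(castSite z : Site (F.P Kt) (k i)), ⟨0, h0⟩⟩ : PBond (F.P Kt) (k i)) ∨
              b₀ ∈ feeds (k i) (⟨((castSite z : Site (F.P Kt) (k i))).shift ⟨0, h0⟩, ν'⟩ : PBond (F.P Kt) (k i)) ∨
              b₀ ∈ feeds (k i) (⟨((castSite z : Site (F.P Kt) (k i))).shift ν', ⟨0, h0⟩⟩ : PBond (F.P Kt) (k i)) ∨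
              b₀ ∈ feeds (k i) (⟨(castSite z : Site (F.P Kt) (k i)), ν'⟩ : PBond (F.P Kt) (k i))) →
            ‖((gaugeAct σ U₀ b₀ : SU2) : Matrix (Fin 2) (Fin 2) ℂ) - 1‖ ≤ δ i))
      -- THE PLAQUETTE LETTER at tolerance `δ i`: every (2.12) minimiser of the guarded datum is `δ i`-plaquette-small on the plaquettes with a bond starting in `Ω₁(Z_i)` (P1 and the
      -- chart half's (μ)-row input; the class ∕ [15] Thm 1 (8) reading)
      (hPχ : ∀ i (Vk : GaugeField (F.P Kt) (k i) SU2), PlaqSmallOn (plaqsInside (pts (k i) (Z i ∩ (Λ i)ᶜ))) (eR i) Vk →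
      (∀ b ∈ (boxBonds (LO i) (HI i) : Set (PBond (F.P Kt) (k i))), dist1 (ext i Vk b) ≤ ρn i) →
      ∀ U₀ : GaugeField (F.P Kt) 0 SU2,
        IsMinimizer (Node00.avOfRecord F 2 Kt) (Node00.regMSCoPOfRecord F 2 ν Kt (k i) (maxDomT ν.M₁ (Z i))) (Bj ν.M₁ (Z i) (k i))
          (avgFamily (Node00.avOfRecord F 2 Kt) (qsstarGIter0 (k i) (ext i Vk))) U₀ →
        ∀ p : Plaq (F.P Kt) 0, ((⟨p.src, p.μ⟩ : PBond (F.P Kt) 0) ∈ {b : PBond (F.P Kt) 0 | b.src ∈ maxDomT ν.M₁ (Z i) 1} ∨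
            (⟨p.src.shift p.μ, p.ν⟩ : PBond (F.P Kt) 0) ∈ {b : PBond (F.P Kt) 0 | b.src ∈ maxDomT ν.M₁ (Z i) 1} ∨
            (⟨p.src.shift p.ν, p.μ⟩ : PBond (F.P Kt) 0) ∈ {b : PBond (F.P Kt) 0 | b.src ∈ maxDomT ν.M₁ (Z i) 1} ∨
            (⟨p.src, p.ν⟩ : PBond (F.P Kt) 0) ∈ {b : PBond (F.P Kt) 0 | b.src ∈ maxDomT ν.M₁ (Z i) 1}) →
          ‖((GaugeField.plaqHol U₀ p : SU2) : Matrix (Fin 2) (Fin 2) ℂ) - 1‖ ≤ δ i),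
      ∃ a₁ : ι → ℝ, (∀ i, 0 < a₁ i) ∧
      B15.Prop1Printed (lfVarOn su2Chart fun i =>
        InstOn.std (Node00.bgMSCoPOfRecord F 2 ν Kt (k i) (maxDomT ν.M₁ (Z i))) ν.M₁ (Z i) (Λ i) (k i) (M i) (a₁ i)
          (anExt (pts (k i) (Λ i)) (T i)
            (fun177std (Node00.bgMSCoPOfRecord F 2 ν Kt (k i) (maxDomT ν.M₁ (Z i))) ν.M₁ (Z i) (k i)) (ext i)
            (min (1 / 2) (min (R i / 8) (γ / (M i) ^ 5 * (R i / 2) ^ 2 /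
              (48 * (4 * ((Fintype.card (Plaq (F.P Kt) 0) : ℝ) * (1 + 8 * 𝓐₀ i ^ 4)) / R i + 1))))))) := by
  classical
  have hk : ∀ i, k i ≤ (F.P Kt).m + (F.P Kt).K := fun i => Nat.le_of_succ_le (hk1 i)
  -- `d = 4`: the chart half's level factor `((L^d)^k ∕ (L²·L²)^k)` is `1`
  have hL : (0 : ℝ) < ((F.P Kt).L : ℝ) := Nat.cast_pos.mpr (F.P Kt).L_pos
  have hA : ∀ i, (((F.P Kt).L : ℝ) ^ (F.P Kt).d) ^ (k i) / ((((F.P Kt).L : ℝ)) ^ 2 * ((F.P Kt).L : ℝ) ^ 2) ^ (k i) = 1 := by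
    intro i
    rw [T4Family.P_d, show (((F.P Kt).L : ℝ)) ^ 2 * ((F.P Kt).L : ℝ) ^ 2 = ((F.P Kt).L : ℝ) ^ 4 by ring]
    exact div_self (pow_ne_zero _ (pow_ne_zero _ hL.ne'))
  have hd1 : 1 ≤ (F.P Kt).d := le_trans (by norm_num) hd3
  have hd1r : (1 : ℝ) ≤ ((F.P Kt).d : ℝ) := by exact_mod_cast hd1
  -- the enlarged window box fits (from `hN5`)
  have hbox3 : ∀ i κ, ((((hi i κ - lo i κ + 1).toNat + 3 : ℕ) : ℤ)) ≤ (F.P Kt).sitesPerDir (k i) := by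
    intro i κ; have := hN5 i κ; push_cast; linarith
  intro δ hδpos hδle hσW hPχ
  have hδρ : ∀ i, δ i < ρ i := fun i => by
    have h := (hδle i).trans (min_le_left _ _); have := min_le_left (ρ i) (ρτ i); have := hρ i; linarith
  have hδρτ : ∀ i, δ i < ρτ i := fun i => by
    have h := (hδle i).trans (min_le_left _ _); have := min_le_right (ρ i) (ρτ i); have := hρτ i; linarith
  -- below the explicit numerics threshold (`Cε := 1` spelled `… * 1` in `hsm_direct_of_le_explicitThreshold`)
  have hδΘ : ∀ i, δ i ≤ min 1 (1 / 2 / (2 * (3 * (K i : ℝ) ^ 2 + 2 * (K i : ℝ) ^ 4)) /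
      (max ((32 * (((F.P Kt).d : ℝ) - 1) + 8 * (((F.P Kt).d : ℝ) - 1) * 1 + (2 * (((F.P Kt).d : ℝ) - 1) * B₁ i * M₂ i)) * (12 * 𝓐₀ i / R i * Real.sqrt (Nat.card {b : PBond (F.P Kt) 0 // b.src ∈ maxDomT ν.M₁ (Z i) 1})) ^ 2
        + (8 * (((F.P Kt).d : ℝ) + 1) * (2 * (Kτ i + 1)) + 8 * ((F.P Kt).d : ℝ) * (((box (fun κ => (hi i κ - lo i κ + 1).toNat + 3) (fun κ => lo i κ - 2)).image (fun z => (castSite z : Site (F.P Kt) (k i)))).card : ℝ) * (C i * (12 * 𝓐₀ i / R i * Real.sqrt (Nat.card {b : PBond (F.P Kt) 0 // b.src ∈ maxDomT ν.M₁ (Z i) 1}))) ^ 2)) 0 + 1)) := fun i => by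
    rw [mul_one]; exact (hδle i).trans (min_le_right _ _)
  have hδone : ∀ i, δ i ≤ 1 := fun i => (hδΘ i).trans (min_le_left _ _)
  -- `τ(δ) ≤ Cτ·δ` for `δ ≤ 1`
  have hτ : ∀ i, (8 * (((F.P Kt).d : ℝ) + 1) * (2 * (Kτ i + 1) * δ i) + 8 * ((F.P Kt).d : ℝ) * (((box (fun κ => (hi i κ - lo i κ + 1).toNat + 3) (fun κ => lo i κ - 2)).image (fun z => (castSite z : Site (F.P Kt) (k i)))).card : ℝ) * (C i * δ i * (12 * 𝓐₀ i / R i * Real.sqrt (Nat.card {b : PBond (F.P Kt) 0 // b.src ∈ maxDomT ν.M₁ (Z i) 1}))) ^ 2) ≤ (8 * (((F.P Kt).d : ℝ) + 1) * (2 * (Kτ i + 1)) + 8 * ((F.P Kt).d : ℝ) * (((box (fun κ => (hi i κ - lo i κ + 1).toNat + 3) (fun κ => lo i κ - 2)).image (fun z => (castSite z : Site (F.P Kt) (k i)))).card : ℝ) * (C i * (12 * 𝓐₀ i / R i * Real.sqrt (Nat.card {b : PBond (F.P Kt) 0 // b.src ∈ maxDomT ν.M₁ (Z i) 1}))) ^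 2) * δ i := by
    intro i
    have hN0 : (0 : ℝ) ≤ (((box (fun κ => (hi i κ - lo i κ + 1).toNat + 3) (fun κ => lo i κ - 2)).image (fun z => (castSite z : Site (F.P Kt) (k i)))).card : ℝ) := by positivity
    have hq : (C i * δ i * (12 * 𝓐₀ i / R i * Real.sqrt (Nat.card {b : PBond (F.P Kt) 0 // b.src ∈ maxDomT ν.M₁ (Z i) 1}))) ^ 2 = (C i * (12 * 𝓐₀ i / R i * Real.sqrt (Nat.card {b : PBond (F.P Kt) 0 // b.src ∈ maxDomT ν.M₁ (Z i) 1}))) ^ 2 * (δ i * δ i) := by ring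
    have h2 : δ i * δ i ≤ δ i := by nlinarith [hδpos i, hδone i]
    have h3 : (0 : ℝ) ≤ 8 * ((F.P Kt).d : ℝ) * (((box (fun κ => (hi i κ - lo i κ + 1).toNat + 3) (fun κ => lo i κ - 2)).image (fun z => (castSite z : Site (F.P Kt) (k i)))).card : ℝ) * (C i * (12 * 𝓐₀ i / R i * Real.sqrt (Nat.card {b : PBond (F.P Kt) 0 // b.src ∈ maxDomT ν.M₁ (Z i) 1}))) ^ 2 := by positivity
    have h4 : (0 : ℝ) ≤ 8 * (((F.P Kt).d : ℝ) + 1) * (2 * (Kτ i + 1)) := by have := hKτ i; positivity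
    rw [hq]; nlinarith [h3, h4, h2, (hδpos i).le]
  have hd1' : (0 : ℝ) ≤ ((F.P Kt).d : ℝ) - 1 := by linarith
  have hμc0 : ∀ i, 0 ≤ 2 * (((F.P Kt).d : ℝ) - 1) * δ i * B₁ i * M₂ i := fun i => by
    have h1 := hB1 i; have h2 := hM₂0 i; have h3 := (hδpos i).le; positivity
  refine exists_domain_prop1Printed_lfVarOn_std_su2_box_intrinsic_analytic_atZSeqCoPRecord_ofThm1TorusClass_ofMinimiserFamily_ofWindowLetters_ofCoercive
    ν Kt hd3 h0 Z Λ k M hk0 hk eR heR T lo hi n hn hN hbox hZ hTG0 hN5 K hK1 hKn ext hext hlohi LO HI hLO hHI n' hn' hn'N hR' ρn hρn hγ hcJ hbx hbxM hM hR hMin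
    (γ₀ := 1 / 2) (by norm_num) W
    (δc := δ) (εc := δ) (δW := δ) (μc := fun i => 2 * (((F.P Kt).d : ℝ) - 1) * δ i * B₁ i * M₂ i)
    (Kc := fun i => (12 * 𝓐₀ i / R i * Real.sqrt (Nat.card {b : PBond (F.P Kt) 0 // b.src ∈ maxDomT ν.M₁ (Z i) 1})))
    (τc := fun i => (8 * (((F.P Kt).d : ℝ) + 1) * (2 * (Kτ i + 1) * δ i) + 8 * ((F.P Kt).d : ℝ) * (((box (fun κ => (hi i κ - lo i κ + 1).toNat + 3) (fun κ => lo i κ - 2)).image (fun z => (castSite z : Site (F.P Kt) (k i)))).card : ℝ) * (C i * δ i * (12 * 𝓐₀ i / R i * Real.sqrt (Nat.card {b : PBond (F.P Kt) 0 // b.src ∈ maxDomT ν.M₁ (Z i) 1}))) ^ 2))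
    (fun i => (hδpos i).le) (fun i => (hδpos i).le) hμc0
    hσW
    (fun i Vk hg hdat U₀ hmin p _ hp => hPχ i Vk hg hdat U₀ hmin p hp)
    (fun i Vk hg hdat U₀ Xf hmin _ hfeeds hX0 hC2 hfam hK' hsupp => ?_)
    (fun i => ?_) hγle hfar hZblk hM2 hdiv hcE0 hcE hB₃ heRa ha₀ hcA h15T hcJ'
  · -- (χ)_W from the ρ6b chart half at the (P4)′ witness and its per-row preimage letter
    obtain ⟨H, hHinv, hrow⟩ := hH i Vk hg hdat U₀ hmin
    -- the chart half's ℓ² VELOCITY LETTER at today's inhabitant `K₂ := 12·𝓐₀∕R·√#{b ∕∕ b.src ∈ Ω₁(Z_i)}` — from (J0′)'s per-bond Cauchy bound and the support of the velocity (ρ6b's `hK2`)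
    have hK2 : ∀ X : GaugeSlice (pts (k i) (Λ i)) (T i) E3, Real.sqrt (∑ b, ‖fderiv ℝ Xf 0 X b‖ ^ 2)
        ≤ (12 * 𝓐₀ i / R i * Real.sqrt (Nat.card {b : PBond (F.P Kt) 0 // b.src ∈ maxDomT ν.M₁ (Z i) 1})) * ‖X‖ := fun X => by
      have hle := l2Seminorm_le_of_bound_of_support (N := 2) (maxDomT ν.M₁ (Z i) 1) (fderiv ℝ Xf 0 X) (a := 12 * 𝓐₀ i / R i * ‖X‖)
        (by have := hR i; have := h𝓐₀ i; positivity) (fun b => (hK' X b).2) (fun b hb => hsupp X b hb)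
      rw [l2Seminorm_apply] at hle
      calc Real.sqrt (∑ b, ‖fderiv ℝ Xf 0 X b‖ ^ 2) ≤ Real.sqrt (Nat.card {b : PBond (F.P Kt) 0 // b.src ∈ maxDomT ν.M₁ (Z i) 1}) * (12 * 𝓐₀ i / R i * ‖X‖) := hle
        _ = (12 * 𝓐₀ i / R i * Real.sqrt (Nat.card {b : PBond (F.P Kt) 0 // b.src ∈ maxDomT ν.M₁ (Z i) 1})) * ‖X‖ := by ring
    obtain ⟨Ψ₂, lam, p, h1, h2, h3, h4, h5⟩ := hhalf i ν (Z i) (Λ i) (T i) (lo i) (hi i) (hbox3 i) (hΩw i) (hk1 i) hM4 (hdiv i) hεreg.le (hερ i) (ext i) Vk U₀ Xf hmin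
      (hδpos i).le
      (hPχ i Vk hg hdat U₀ hmin) H hHinv (hB1 i) hrow (hM₂ i Vk hg hdat U₀ hmin) hX0 hC2 hfam hK2 (W i) (hWbox i) (hδpos i) (hδρ i) (hδρτ i) hfeeds
    refine ⟨Ψ₂, lam, p, h1, h2, h3, h4, fun X => ⟨?_, (h5 X).2.1, ?_⟩⟩
    · have := (h5 X).1
      calc lam (Ψ₂ (fderiv ℝ Xf 0 X) (fderiv ℝ Xf 0 X))
          ≤ (2 * (((F.P Kt).d : ℝ) - 1) * δ i * B₁ i * M₂ i) * p (fderiv ℝ Xf 0 X) ^ 2 := this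
        _ = _ := rfl
    · have hc := (h5 X).2.2
      rw [hA i, one_mul] at hc
      exact hc
  · -- the numerics `hsm` at the pinned constants, from the thresholds
    have hμ : 2 * (((F.P Kt).d : ℝ) - 1) * δ i * B₁ i * M₂ i ≤ (2 * (((F.P Kt).d : ℝ) - 1) * B₁ i * M₂ i) * δ i :=
      le_of_eq (by ring)
    exact hsm_direct_of_le_explicitThreshold hd1 (hK1 i) (by norm_num) _ 1 _ _ (hδpos i).le (hδΘ i) le_rfl (by rw [one_mul]) hμ (hτ i)

end Summit.QuantumFields.YangMills.BalabanUVNodes.N12Prop1DirectOfChartHalfOfClassRowL1Explicit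

end
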